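import Summits.CriticalPhenomena.PercolationContinuityZ3.Theorems.PercNearOneGluingNoHeavyConstsClusterSquareApicesQuadLinked
import Summits.CriticalPhenomena.PercolationContinuityZ3.Theorems.PercNearOneGluingNoHeavyConstsClusterSquareQuadClash
import HarnessLib

/-!
# Outerplanar graph plus independent apices: CSQ/DUU at every RIM root for ARBITRARY terminals, TS for every triple with a rim vertex

builds on p205010 (kernel theorem, internal audit signed; external expert review pending)

PAPER-2 track "percolation constants", part (ii), seat `prim-consts-1`, gen 22 (lane index
`run/shared/lean/prim/consts/CONSTANTS.md`, row A19; memo `FROM-prim-consts-1-g22-CROSS-LINKAGE.md`).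
Support file for the crux `NoHeavyLowerTail` (stmt-CriticalPhenomena-4575; `--supports`).  Theorems only; no definitions, no sorries.

THE CLASS (gen 20, `…ConstsClusterSquareApices.lean`): `H` on `Fin n`; a predicate `hub` marks the APICES, the other (RIM) vertices
carry positions `pos u : Fin m`, injective on the rim; (I) apices pairwise non-adjacent; (R) rim edges pairwise non-crossing; (F) no
rim edge separates two neighbours of an apex; (L) no chord between two neighbours of one apex interleaves a chord between two
neighbours of another; (L2) two apices have at most two common neighbours — an outerplanar graph with an independent set of extra
vertices drawn inside its faces.  Gen 20 proved CSQ/DUU/TS for RIM terminals (no double clash); gen 21 the one-apex case with the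
apex as a terminal (no quadruple clash).  HERE, for any number of apices and ANY terminals:
* `Consts.not_quadClash_of_unlinked₄` (`…ApicesQuadLinked.lean`, general vertex type): a quadruple clash at `(a; b, c)`
  (gen 18, `Consts.clusterSquare_le_sq_of_noQuadClash_pos`) yields a CROSS-LINKAGE at the cluster `K = C_a(ω)` — four distinct clash vertices
  `y, y', z, z' ∉ K` joined to `K` with walks `y → z ∥ y' → z'` and `y' → z ∥ y → z'` in `H − K` (disjoint supports within each
  pair); the terminals `b, c` disappear (they only glue the clusters);
* `Consts.Apices.unlinked₄`: in the class (I)(R)(F)(L)(L2) no `H`-connected `K` containing a RIM vertex carries a cross-linkage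
  (endgame `Consts.Apices.false_of_quad` of `…ApicesQuadLinked.lean`, graphs instantiated by `SimpleGraph.fromRel` as in
  `Consts.Apices.unlinked`);
* **`Consts.clusterSquare_le_sq_of_apices_rim`, `Consts.sq_real_split_le_of_apices_rim`** — CSQ and DUU at every RIM root `a` for
  EVERY pair of terminals `b, c` (rim or apex; coincidences `b = a`, `c = a`, `b = c` are the trivial `0 = 0` cases — the content
  is three distinct terminals with a rim root) and every weight vector supported on `H`;
* **`Consts.tripleSplit_of_apices_rim`** — TS `μ(a↮b, a↮c, b↮c)² ≤ μ(a↮b) μ(a↮c) μ(b↮c)` whenever `a` is on the rim, i.e. for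
  every triple of terminals containing a rim vertex; concrete `Fin (N + M)` form **`Consts.tripleSplit_apices_rim (a : Fin N)
  (b c : Fin (N + M))`**, one-apex form **`Consts.tripleSplit_of_apex_rim`** ((R)+(F) only; `a ≠ h` rim, `b, c` arbitrary).  This
  subsumes `Consts.tripleSplit_of_apices` (rim triples) and, for one apex, `Consts.tripleSplit_of_apex` / `Consts.tripleSplit_of_apex_hub`.
What is NOT covered: triples of three apices, and CSQ/DUU rooted at an apex (quadruple clashes occur there: `W₄` rooted at the hub).
Census (lane engine g22 `eng/quad4.py`, kit jobs j214549 / j214834; exhaustive over ALL (I)(R)(F)(L)(L2) graphs): the cross-linkage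
statement holds with one apex and ≤ 8 rim vertices (8 884 224 graphs at 8), two apices and ≤ 7 rim vertices (12 005 760 graphs at 7;
4 608 176 076 rim-rooted clusters, 243 421 906 of them with one realisable matching, 0 with two) and three apices and ≤ 6 rim vertices
(6 969 088 graphs, 2 721 705 120 clusters); every hypothesis is needed (controls at 5 rim vertices, two apices: apex root / (L) / (L2) /
(F) dropped give 456 / 4 405 / 5 100 / 47 785 cross-linked clusters).
References: N. Gladkov, arXiv:2408.08457v2 (2024), Def. 4.2, Thm. 4.3, Lemma 3.1, Ex. 2.5, Thm. 5.2, Cor. 5.3; J. van den Berg,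
O. Häggström, J. Kahn, Random Structures Algorithms 29 (2006), §1; G. Chartrand, F. Harary, Ann. Inst. H. Poincaré B 3 (1967) 433–438.
-/

noncomputable section

open Classical

namespace Summit.CriticalPhenomena.PercolationContinuityZ3.Theorems

open MeasureTheory Finset Literature.Probability.LatticeModels Literature.Probability.Percolation
open Literature.Probability.Percolation.DecisionTree Literature.Probability.Percolation.BHK2006
open Literature.Probability.Percolation.TargetExploration Literature.Probability.Percolation.ClusterConditioning

namespace Consts


namespace Apices

variable {n m : ℕ}

/-- **No `H`-connected `K` containing a RIM vertex `a` carries a cross-linkage of four clash vertices, when `H` is an outerplanar rim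
graph plus an independent set of apices inside faces** (hypotheses (I), (R), (F), (L), (L2) of `…ConstsClusterSquareApices.lean`;
the clash vertices may be rim vertices or apices): the hypothesis `hK` of `Consts.not_quadClash_of_unlinked₄` holds.
[folklore: Jordan curve theorem] -/
theorem unlinked₄ (H : SimpleGraph (Fin n)) (hub : Fin n → Prop) (pos : Fin n → Fin m)
    (hpos : ∀ u v, ¬ hub u → ¬ hub v → pos u = pos v → u = v)
    (hI : ∀ u v, hub u → hub v → ¬ H.Adj u v)
    (hR : ∀ p q r s : Fin n, ¬ hub p → ¬ hub q → ¬ hub r → ¬ hub s → H.Adj p q → H.Adj r s →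
      pos p < pos r → pos r < pos q → pos q < pos s → False)
    (hF : ∀ x p q u v : Fin n, hub x → ¬ hub p → ¬ hub q → H.Adj p q → H.Adj x u → H.Adj x v →
      pos p < pos u → pos u < pos q → (pos q < pos v ∨ pos v < pos p) → False)
    (hL : ∀ x x' u v u' v' : Fin n, hub x → hub x' → x ≠ x' → H.Adj x u → H.Adj x v → H.Adj x' u' → H.Adj x' v' →
      pos u < pos u' → pos u' < pos v → pos v < pos v' → False)
    (hL2 : ∀ x x' u v w : Fin n, hub x → hub x' → x ≠ x' → u ≠ v → u ≠ w → v ≠ w →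
      H.Adj x u → H.Adj x v → H.Adj x w → H.Adj x' u → H.Adj x' v → H.Adj x' w → False)
    {a : Fin n} (ha : ¬ hub a) :
    ∀ (K : Set (Fin n)) (y y' z z' : Fin n), a ∈ K →
      (∀ T : Set (Fin n), a ∈ T → (∀ u x, u ∈ T → H.Adj u x → x ∈ K → x ∈ T) → K ⊆ T) →
      y ∉ K → y' ∉ K → z ∉ K → z' ∉ K →
      (∃ k, k ∈ K ∧ H.Adj k y) → (∃ k, k ∈ K ∧ H.Adj k y') → (∃ k, k ∈ K ∧ H.Adj k z) → (∃ k, k ∈ K ∧ H.Adj k z') →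
      y ≠ y' → y ≠ z → y ≠ z' → y' ≠ z → y' ≠ z' → z ≠ z' →
      (∀ (R₁ : H.Walk y z) (R₂ : H.Walk y' z'), (∀ x ∈ R₁.support, x ∉ K) → (∀ x ∈ R₂.support, x ∉ K) →
          ∃ x, x ∈ R₁.support ∧ x ∈ R₂.support) ∨
      (∀ (R₃ : H.Walk y' z) (R₄ : H.Walk y z'), (∀ x ∈ R₃.support, x ∉ K) → (∀ x ∈ R₄.support, x ∉ K) →
          ∃ x, x ∈ R₃.support ∧ x ∈ R₄.support) := by
  intro K y y' z z' haK hcl hyK hy'K hzK hz'K hky hky' hkz hkz' hyy' hyz hyz' hy'z hy'z' hzz'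
  -- the rim graph, the contracted graphs and the chord graphs
  let G₀ : SimpleGraph (Fin n) := SimpleGraph.fromRel fun u v => H.Adj u v ∧ ¬ hub u ∧ ¬ hub v
  let Hp : Set (Fin n) → SimpleGraph (Fin n) := fun S => SimpleGraph.fromRel fun u v =>
    ¬ hub u ∧ ¬ hub v ∧ (H.Adj u v ∨ ∃ x, hub x ∧ x ∈ S ∧ H.Adj x u ∧ H.Adj x v)
  let C : Fin n → SimpleGraph (Fin n) := fun x => SimpleGraph.fromRel fun u v => ¬ hub u ∧ ¬ hub v ∧ H.Adj x u ∧ H.Adj x v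
  have hG₀ : ∀ u v, G₀.Adj u v → H.Adj u v ∧ ¬ hub u ∧ ¬ hub v := by
    intro u v huv
    rcases (SimpleGraph.fromRel_adj _ u v).1 huv with ⟨_, ⟨e, hu, hv⟩ | ⟨e, hv, hu⟩⟩
    · exact ⟨e, hu, hv⟩
    · exact ⟨e.symm, hu, hv⟩
  have hHp : ∀ S u v, (Hp S).Adj u v → ¬ hub u ∧ ¬ hub v ∧ (H.Adj u v ∨ ∃ x, hub x ∧ x ∈ S ∧ H.Adj x u ∧ H.Adj x v) := by
    intro S u v huv
    rcases (SimpleGraph.fromRel_adj _ u v).1 huv with ⟨_, ⟨hu, hv, e⟩ | ⟨hv, hu, e⟩⟩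
    · exact ⟨hu, hv, e⟩
    · rcases e with e | ⟨x, hx, hxS, e1, e2⟩
      · exact ⟨hu, hv, Or.inl e.symm⟩
      · exact ⟨hu, hv, Or.inr ⟨x, hx, hxS, e2, e1⟩⟩
  have hC : ∀ x u v, (C x).Adj u v → ¬ hub u ∧ ¬ hub v ∧ H.Adj x u ∧ H.Adj x v := by
    intro x u v huv
    rcases (SimpleGraph.fromRel_adj _ u v).1 huv with ⟨_, ⟨hu, hv, e1, e2⟩ | ⟨hv, hu, e2, e1⟩⟩
    · exact ⟨hu, hv, e1, e2⟩
    · exact ⟨hu, hv, e1, e2⟩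
  have g1 : ∀ u v, H.Adj u v → ¬ hub u → ¬ hub v → G₀.Adj u v := fun u v e hu hv =>
    (SimpleGraph.fromRel_adj _ u v).2 ⟨e.ne, Or.inl ⟨e, hu, hv⟩⟩
  have g2 : ∀ S u v, H.Adj u v → ¬ hub u → ¬ hub v → (Hp S).Adj u v := fun S u v e hu hv =>
    (SimpleGraph.fromRel_adj _ u v).2 ⟨e.ne, Or.inl ⟨hu, hv, Or.inl e⟩⟩
  have g3 : ∀ (S : Set (Fin n)) x u v, hub x → x ∈ S → u ≠ v → ¬ hub u → ¬ hub v → H.Adj x u → H.Adj x v →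
      (Hp S).Adj u v := fun S x u v hx hxS huv hu hv e1 e2 =>
    (SimpleGraph.fromRel_adj _ u v).2 ⟨huv, Or.inl ⟨hu, hv, Or.inr ⟨x, hx, hxS, e1, e2⟩⟩⟩
  have c1 : ∀ x u v, hub x → u ≠ v → ¬ hub u → ¬ hub v → H.Adj x u → H.Adj x v → (C x).Adj u v :=
    fun x u v _ huv hu hv e1 e2 => (SimpleGraph.fromRel_adj _ u v).2 ⟨huv, Or.inl ⟨hu, hv, e1, e2⟩⟩
  -- no `Hp S`-edge crosses a `G₀`-edge; no `Hp S`-edge crosses a `C x`-chord for `x ∉ S`; no two chords of distinct apices cross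
  have y0 : ∀ (S : Set (Fin n)) p q r s, (Hp S).Adj p q → G₀.Adj r s →
      pos p < pos r → pos r < pos q → pos q < pos s → False := by
    intro S p q r s hpq hrs l1 l2 l3
    obtain ⟨hp, hq, e⟩ := hHp S p q hpq
    obtain ⟨ers, hr, hs⟩ := hG₀ r s hrs
    rcases e with e | ⟨x, hx, -, e1, e2⟩
    · exact hR p q r s hp hq hr hs e ers l1 l2 l3
    · exact hF x r s q p hx hr hs ers e2 e1 l2 l3 (Or.inr l1)
  have y0' : ∀ (S : Set (Fin n)) p q r s, G₀.Adj p q → (Hp S).Adj r s →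
      pos p < pos r → pos r < pos q → pos q < pos s → False := by
    intro S p q r s hpq hrs l1 l2 l3
    obtain ⟨epq, hp, hq⟩ := hG₀ p q hpq
    obtain ⟨hr, hs, e⟩ := hHp S r s hrs
    rcases e with e | ⟨x, hx, -, e1, e2⟩
    · exact hR p q r s hp hq hr hs epq e l1 l2 l3
    · exact hF x p q r s hx hp hq epq e1 e2 l1 l2 (Or.inl l3)
  have yC : ∀ (S : Set (Fin n)) x p q r s, hub x → x ∉ S → (Hp S).Adj p q → (C x).Adj r s →
      pos p < pos r → pos r < pos q → pos q < pos s → False := by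
    intro S x p q r s hx hxS hpq hrs l1 l2 l3
    obtain ⟨hp, hq, e⟩ := hHp S p q hpq
    obtain ⟨_, _, f1, f2⟩ := hC x r s hrs
    rcases e with e | ⟨x', hx', hx'S, e1, e2⟩
    · exact hF x p q r s hx hp hq e f1 f2 l1 l2 (Or.inl l3)
    · exact hL x' x p q r s hx' hx (fun h => hxS (h ▸ hx'S)) e1 e2 f1 f2 l1 l2 l3
  have yC' : ∀ (S : Set (Fin n)) x p q r s, hub x → x ∉ S → (C x).Adj p q → (Hp S).Adj r s →
      pos p < pos r → pos r < pos q → pos q < pos s → False := by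
    intro S x p q r s hx hxS hpq hrs l1 l2 l3
    obtain ⟨_, _, f1, f2⟩ := hC x p q hpq
    obtain ⟨hr, hs, e⟩ := hHp S r s hrs
    rcases e with e | ⟨x', hx', hx'S, e1, e2⟩
    · exact hF x r s q p hx hr hs e f2 f1 l2 l3 (Or.inr l1)
    · exact hL x x' p q r s hx hx' (fun h => hxS (h.symm ▸ hx'S)) f1 f2 e1 e2 l1 l2 l3
  have yCC : ∀ x x' p q r s, hub x → hub x' → x ≠ x' → (C x).Adj p q → (C x').Adj r s →
      pos p < pos r → pos r < pos q → pos q < pos s → False := by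
    intro x x' p q r s hx hx' hxx' hpq hrs l1 l2 l3
    obtain ⟨_, _, e1, e2⟩ := hC x p q hpq
    obtain ⟨_, _, f1, f2⟩ := hC x' r s hrs
    exact hL x x' p q r s hx hx' hxx' e1 e2 f1 f2 l1 l2 l3
  -- cut open at `a`
  have x0 : ∀ (S : Set (Fin n)) p q r s, (Hp S).Adj p q → G₀.Adj r s → (pos p - pos a).val < (pos r - pos a).val →
      (pos r - pos a).val < (pos q - pos a).val → (pos q - pos a).val < (pos s - pos a).val → False :=
    fun S p q r s hpq hrs => Apex.noncross_rot₂ (y0 S) (y0' S) a hpq hrs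
  have x0' : ∀ (S : Set (Fin n)) p q r s, G₀.Adj p q → (Hp S).Adj r s → (pos p - pos a).val < (pos r - pos a).val →
      (pos r - pos a).val < (pos q - pos a).val → (pos q - pos a).val < (pos s - pos a).val → False :=
    fun S p q r s hpq hrs => Apex.noncross_rot₂ (y0' S) (y0 S) a hpq hrs
  have xC : ∀ (S : Set (Fin n)) x p q r s, hub x → x ∉ S → (Hp S).Adj p q → (C x).Adj r s →
      (pos p - pos a).val < (pos r - pos a).val → (pos r - pos a).val < (pos q - pos a).val →
      (pos q - pos a).val < (pos s - pos a).val → False :=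
    fun S x p q r s hx hxS hpq hrs => Apex.noncross_rot₂ (yC S x · · · · hx hxS) (yC' S x · · · · hx hxS) a hpq hrs
  have xC' : ∀ (S : Set (Fin n)) x p q r s, hub x → x ∉ S → (C x).Adj p q → (Hp S).Adj r s →
      (pos p - pos a).val < (pos r - pos a).val → (pos r - pos a).val < (pos q - pos a).val →
      (pos q - pos a).val < (pos s - pos a).val → False :=
    fun S x p q r s hx hxS hpq hrs => Apex.noncross_rot₂ (yC' S x · · · · hx hxS) (yC S x · · · · hx hxS) a hpq hrs
  have xCC : ∀ x x' p q r s, hub x → hub x' → x ≠ x' → (C x).Adj p q → (C x').Adj r s →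
      (pos p - pos a).val < (pos r - pos a).val → (pos r - pos a).val < (pos q - pos a).val →
      (pos q - pos a).val < (pos s - pos a).val → False :=
    fun x x' p q r s hx hx' hxx' hpq hrs =>
      Apex.noncross_rot₂ (yCC x x' · · · · hx hx' hxx') (yCC x' x · · · · hx' hx hxx'.symm) a hpq hrs
  obtain ⟨ky, hkyK, hky⟩ := hky
  obtain ⟨ky', hky'K, hky'⟩ := hky'
  obtain ⟨kz, hkzK, hkz⟩ := hkz
  obtain ⟨kz', hkz'K, hkz'⟩ := hkz'
  by_contra hcon
  push Not at hcon
  obtain ⟨⟨R₁, R₂, hR₁, hR₂, hd₁₂⟩, ⟨R₃, R₄, hR₃, hR₄, hd₃₄⟩⟩ := hcon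
  have hKw := NonCrossing.walks_of_closure haK hcl
  -- rim representatives of the clash vertices on their walks
  obtain ⟨yω, yθ, hyω, hyωR, hyθ, hyθR, hy⟩ := exists_reps hI R₁ R₄ hyz hyz'
  obtain ⟨y'ω, y'θ, hy'ω, hy'ωR, hy'θ, hy'θR, hy'⟩ := exists_reps hI R₂ R₃ hy'z' hy'z
  obtain ⟨zω, zθ, hzω, hzωR, hzθ, hzθR, hz⟩ := exists_reps hI R₁.reverse R₃.reverse (Ne.symm hyz) (Ne.symm hy'z)
  obtain ⟨z'ω, z'θ, hz'ω, hz'ωR, hz'θ, hz'θR, hz'⟩ := exists_reps hI R₂.reverse R₄.reverse (Ne.symm hy'z') (Ne.symm hyz')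
  rw [SimpleGraph.Walk.support_reverse, List.mem_reverse] at hzωR hzθR hz'ωR hz'θR
  exact false_of_quad hpos hI g1 g2 g3 c1 x0 x0' xC xC' xCC ha hL2 hKw hyK hy'K hzK hz'K hkyK hky hky'K hky' hkzK hkz hkz'K hkz'
    hyy' hzz' R₁ R₂ hR₁ hR₂ hd₁₂ R₃ R₄ hR₃ hR₄ hd₃₄ hyω hyωR hyθ hyθR hy hy'ω hy'ωR hy'θ hy'θR hy' hzω hzωR hzθ hzθR hz
    hz'ω hz'ωR hz'θ hz'θR hz'

end Apices

/-! ### CSQ, DUU, TS at a rim root, arbitrary terminals -/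

section Fin

variable {n m : ℕ} (w : Sym2 (Fin n) → unitInterval) (a b c : Fin n) (H : SimpleGraph (Fin n)) (hub : Fin n → Prop)
  (pos : Fin n → Fin m)

/-- **CSQ at a RIM root for an outerplanar rim graph plus independent apices inside faces, ARBITRARY terminals** (hypotheses (I), (R),
(F), (L), (L2) as in `Consts.Apices.unlinked`; `H ⊇` positive pairs of `w`; `a` on the rim, `b, c` any vertices):
`clusterSquare w a b c ≤ μ(b ↮ c)²`, via "no quadruple clash". [cite: Gladkov2024, Thm. 4.3, Def. 4.2, Lemma 3.1, Ex. 2.5] -/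
theorem clusterSquare_le_sq_of_apices_rim (hH : ∀ u v, u ≠ v → (0 : ℝ) < w s(u, v) → H.Adj u v)
    (hpos : ∀ u v, ¬ hub u → ¬ hub v → pos u = pos v → u = v) (hI : ∀ u v, hub u → hub v → ¬ H.Adj u v)
    (hR : ∀ p q r s : Fin n, ¬ hub p → ¬ hub q → ¬ hub r → ¬ hub s → H.Adj p q → H.Adj r s →
      pos p < pos r → pos r < pos q → pos q < pos s → False)
    (hF : ∀ x p q u v : Fin n, hub x → ¬ hub p → ¬ hub q → H.Adj p q → H.Adj x u → H.Adj x v →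
      pos p < pos u → pos u < pos q → (pos q < pos v ∨ pos v < pos p) → False)
    (hL : ∀ x x' u v u' v' : Fin n, hub x → hub x' → x ≠ x' → H.Adj x u → H.Adj x v → H.Adj x' u' → H.Adj x' v' →
      pos u < pos u' → pos u' < pos v → pos v < pos v' → False)
    (hL2 : ∀ x x' u v t : Fin n, hub x → hub x' → x ≠ x' → u ≠ v → u ≠ t → v ≠ t →
      H.Adj x u → H.Adj x v → H.Adj x t → H.Adj x' u → H.Adj x' v → H.Adj x' t → False)
    (ha : ¬ hub a) :
    clusterSquare w a b c ≤ (prodBernoulli w).real (openConn b c)ᶜ ^ 2 :=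
  clusterSquare_le_sq_of_noQuadClash_pos w a b c fun _ _ hω hη hab hac hbc hbc' =>
    not_quadClash_of_unlinked₄ H w hH (Apices.unlinked₄ H hub pos hpos hI hR hF hL hL2 ha) hω hη hab hac hbc hbc'

/-- **DUU at a RIM root for an outerplanar rim graph plus independent apices inside faces, arbitrary terminals**:
`μ(a↮b, a↮c, b↮c)² ≤ μ(a↮b, a↮c) · μ(b↮c)²`. [cite: Gladkov2024, Thm. 5.2 and Thm. 4.3] -/
theorem sq_real_split_le_of_apices_rim (hH : ∀ u v, u ≠ v → (0 : ℝ) < w s(u, v) → H.Adj u v)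
    (hpos : ∀ u v, ¬ hub u → ¬ hub v → pos u = pos v → u = v) (hI : ∀ u v, hub u → hub v → ¬ H.Adj u v)
    (hR : ∀ p q r s : Fin n, ¬ hub p → ¬ hub q → ¬ hub r → ¬ hub s → H.Adj p q → H.Adj r s →
      pos p < pos r → pos r < pos q → pos q < pos s → False)
    (hF : ∀ x p q u v : Fin n, hub x → ¬ hub p → ¬ hub q → H.Adj p q → H.Adj x u → H.Adj x v →
      pos p < pos u → pos u < pos q → (pos q < pos v ∨ pos v < pos p) → False)
    (hL : ∀ x x' u v u' v' : Fin n, hub x → hub x' → x ≠ x' → H.Adj x u → H.Adj x v → H.Adj x' u' → H.Adj x' v' →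
      pos u < pos u' → pos u' < pos v → pos v < pos v' → False)
    (hL2 : ∀ x x' u v t : Fin n, hub x → hub x' → x ≠ x' → u ≠ v → u ≠ t → v ≠ t →
      H.Adj x u → H.Adj x v → H.Adj x t → H.Adj x' u → H.Adj x' v → H.Adj x' t → False)
    (ha : ¬ hub a) :
    (prodBernoulli w).real ((openConn a b)ᶜ ∩ (openConn a c)ᶜ ∩ (openConn b c)ᶜ) ^ 2 ≤
      (prodBernoulli w).real ((openConn a b)ᶜ ∩ (openConn a c)ᶜ) * (prodBernoulli w).real (openConn b c)ᶜ ^ 2 :=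
  sq_real_split_le_of_noQuadClash_pos w a b c fun _ _ hω hη hab hac hbc hbc' =>
    not_quadClash_of_unlinked₄ H w hH (Apices.unlinked₄ H hub pos hpos hI hR hF hL hL2 ha) hω hη hab hac hbc hbc'

/-- **TS for every triple with a RIM vertex on an outerplanar rim graph plus independent apices inside faces** (root the triple at
its rim vertex `a`; `b, c` arbitrary): `μ(a↮b, a↮c, b↮c)² ≤ μ(a↮b) · μ(a↮c) · μ(b↮c)`.  Subsumes `Consts.tripleSplit_of_apices`
(rim triples) and `Consts.tripleSplit_of_apex_hub` (one apex). [cite: Gladkov2024, Thm. 5.2, Cor. 5.3 (pattern) and Thm. 4.3] -/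
theorem tripleSplit_of_apices_rim (hH : ∀ u v, u ≠ v → (0 : ℝ) < w s(u, v) → H.Adj u v)
    (hpos : ∀ u v, ¬ hub u → ¬ hub v → pos u = pos v → u = v) (hI : ∀ u v, hub u → hub v → ¬ H.Adj u v)
    (hR : ∀ p q r s : Fin n, ¬ hub p → ¬ hub q → ¬ hub r → ¬ hub s → H.Adj p q → H.Adj r s →
      pos p < pos r → pos r < pos q → pos q < pos s → False)
    (hF : ∀ x p q u v : Fin n, hub x → ¬ hub p → ¬ hub q → H.Adj p q → H.Adj x u → H.Adj x v →
      pos p < pos u → pos u < pos q → (pos q < pos v ∨ pos v < pos p) → False)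
    (hL : ∀ x x' u v u' v' : Fin n, hub x → hub x' → x ≠ x' → H.Adj x u → H.Adj x v → H.Adj x' u' → H.Adj x' v' →
      pos u < pos u' → pos u' < pos v → pos v < pos v' → False)
    (hL2 : ∀ x x' u v t : Fin n, hub x → hub x' → x ≠ x' → u ≠ v → u ≠ t → v ≠ t →
      H.Adj x u → H.Adj x v → H.Adj x t → H.Adj x' u → H.Adj x' v → H.Adj x' t → False)
    (ha : ¬ hub a) :
    (prodBernoulli w).real ((openConn a b)ᶜ ∩ (openConn a c)ᶜ ∩ (openConn b c)ᶜ) ^ 2 ≤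
      (prodBernoulli w).real (openConn a b)ᶜ * (prodBernoulli w).real (openConn a c)ᶜ *
        (prodBernoulli w).real (openConn b c)ᶜ :=
  tripleSplit_of_noQuadClash_pos w a b c fun _ _ hω hη hab hac hbc hbc' =>
    not_quadClash_of_unlinked₄ H w hH (Apices.unlinked₄ H hub pos hpos hI hR hF hL hL2 ha) hω hη hab hac hbc hbc'

/-- **One apex, arbitrary terminals** (the setting of `…ConstsClusterSquareApex.lean`: apex `h`, rim positions injective off `h`, (R) rim
edges non-crossing, (F) no rim edge separates two apex-neighbours; NO sector condition): for every rim `a ≠ h` and ALL `b, c`,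
`μ(a↮b, a↮c, b↮c)² ≤ μ(a↮b) · μ(a↮c) · μ(b↮c)` — `Consts.tripleSplit_of_apex` and `Consts.tripleSplit_of_apex_hub` in one statement
(the predicate `hub := (· = h)`; (I), (L), (L2) are vacuous for a single apex). [cite: Gladkov2024, Thm. 5.2, Cor. 5.3 (pattern) and Thm. 4.3] -/
theorem tripleSplit_of_apex_rim (h : Fin n) (hH : ∀ u v, u ≠ v → (0 : ℝ) < w s(u, v) → H.Adj u v)
    (hpos : ∀ u v, u ≠ h → v ≠ h → pos u = pos v → u = v)
    (hR : ∀ p q r s : Fin n, p ≠ h → q ≠ h → r ≠ h → s ≠ h → H.Adj p q → H.Adj r s →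
      pos p < pos r → pos r < pos q → pos q < pos s → False)
    (hF : ∀ p q u v : Fin n, p ≠ h → q ≠ h → H.Adj p q → H.Adj h u → H.Adj h v →
      pos p < pos u → pos u < pos q → (pos q < pos v ∨ pos v < pos p) → False)
    (ha : a ≠ h) :
    (prodBernoulli w).real ((openConn a b)ᶜ ∩ (openConn a c)ᶜ ∩ (openConn b c)ᶜ) ^ 2 ≤
      (prodBernoulli w).real (openConn a b)ᶜ * (prodBernoulli w).real (openConn a c)ᶜ *
        (prodBernoulli w).real (openConn b c)ᶜ :=
  tripleSplit_of_apices_rim w a b c H (fun v => v = h) pos hH (fun u v hu hv e => hpos u v hu hv e)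
    (fun u v hu hv huv => by rw [hu, hv] at huv; exact huv.ne rfl)
    (fun p q r s hp hq hr hs hpq hrs l1 l2 l3 => hR p q r s hp hq hr hs hpq hrs l1 l2 l3)
    (fun x p q u v hx hp hq hpq hu hv l1 l2 l3 => hF p q u v hp hq hpq (hx ▸ hu) (hx ▸ hv) l1 l2 l3)
    (fun x x' _ _ _ _ hx hx' hxx' _ _ _ _ _ _ _ => absurd (hx.trans hx'.symm) hxx')
    (fun x x' _ _ _ hx hx' hxx' _ _ _ _ _ _ _ _ _ => absurd (hx.trans hx'.symm) hxx') ha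

end Fin

/-! ### Concrete form: vertices `Fin (N + M)`, rim `Fin.castAdd M i` (natural cyclic order), apices = the last `M` vertices -/

/-- **TS rooted at a rim vertex for the weighted "polygon with chords plus `M` interior vertices" graphs on `Fin (N + M)`**: rim
vertices `Fin.castAdd M i` (`i : Fin N`) in their natural cyclic order, apices = the vertices with value `≥ N`; `w` any weight vector
with (I) no positive apex–apex pair, (R) positive rim–rim pairs non-crossing, (F) none of them separating two rim vertices positively
joined to one apex, (L) no two apices with interleaving positive neighbour pairs, (L2) no two apices with three common positive
neighbours.  Then for every rim `a` and ALL vertices `b, c`: `μ(a↮b, a↮c, b↮c)² ≤ μ(a↮b) μ(a↮c) μ(b↮c)` — TS for every triple of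
terminals containing a rim vertex. [cite: Gladkov2024, Thm. 5.2, Cor. 5.3 (pattern) and Thm. 4.3] -/
theorem tripleSplit_apices_rim (N M : ℕ) (w : Sym2 (Fin (N + M)) → unitInterval)
    (hI : ∀ x x' : Fin (N + M), N ≤ x.val → N ≤ x'.val → ¬ (0 : ℝ) < w s(x, x'))
    (hR : ∀ p q r s : Fin N, (0 : ℝ) < w s(Fin.castAdd M p, Fin.castAdd M q) → (0 : ℝ) < w s(Fin.castAdd M r, Fin.castAdd M s) →
      p < r → r < q → q < s → False)
    (hF : ∀ x : Fin (N + M), N ≤ x.val → ∀ p q u v : Fin N, (0 : ℝ) < w s(Fin.castAdd M p, Fin.castAdd M q) →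
      (0 : ℝ) < w s(x, Fin.castAdd M u) → (0 : ℝ) < w s(x, Fin.castAdd M v) → p < u → u < q → (q < v ∨ v < p) → False)
    (hL : ∀ x x' : Fin (N + M), N ≤ x.val → N ≤ x'.val → x ≠ x' → ∀ u v u' v' : Fin N, (0 : ℝ) < w s(x, Fin.castAdd M u) →
      (0 : ℝ) < w s(x, Fin.castAdd M v) → (0 : ℝ) < w s(x', Fin.castAdd M u') → (0 : ℝ) < w s(x', Fin.castAdd M v') →
      u < u' → u' < v → v < v' → False)
    (hL2 : ∀ x x' : Fin (N + M), N ≤ x.val → N ≤ x'.val → x ≠ x' → ∀ u v t : Fin N, u ≠ v → u ≠ t → v ≠ t →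
      (0 : ℝ) < w s(x, Fin.castAdd M u) → (0 : ℝ) < w s(x, Fin.castAdd M v) → (0 : ℝ) < w s(x, Fin.castAdd M t) →
      (0 : ℝ) < w s(x', Fin.castAdd M u) → (0 : ℝ) < w s(x', Fin.castAdd M v) → (0 : ℝ) < w s(x', Fin.castAdd M t) → False)
    (a : Fin N) (b c : Fin (N + M)) :
    (prodBernoulli w).real ((openConn (Fin.castAdd M a) b)ᶜ ∩ (openConn (Fin.castAdd M a) c)ᶜ ∩ (openConn b c)ᶜ) ^ 2 ≤
      (prodBernoulli w).real (openConn (Fin.castAdd M a) b)ᶜ * (prodBernoulli w).real (openConn (Fin.castAdd M a) c)ᶜ *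
        (prodBernoulli w).real (openConn b c)ᶜ := by
  let H : SimpleGraph (Fin (N + M)) := SimpleGraph.fromRel fun u v => (0 : ℝ) < w s(u, v)
  have hH : ∀ u v, u ≠ v → (0 : ℝ) < w s(u, v) → H.Adj u v := fun u v huv hw =>
    (SimpleGraph.fromRel_adj _ u v).2 ⟨huv, Or.inl hw⟩
  have hH' : ∀ u v, H.Adj u v → (0 : ℝ) < w s(u, v) := by
    intro u v huv
    rcases (SimpleGraph.fromRel_adj _ u v).1 huv with ⟨_, e | e⟩
    · exact e
    · rwa [Sym2.eq_swap] at e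
  -- every rim vertex is a `castAdd`
  have hcast : ∀ u : Fin (N + M), ¬ N ≤ u.val → ∃ i : Fin N, u = Fin.castAdd M i := fun u hu =>
    ⟨⟨u.val, by omega⟩, Fin.ext (by simp)⟩
  have hlt : ∀ p r : Fin N, Fin.castAdd M p < Fin.castAdd M r → p < r := fun p r h => by
    rw [Fin.lt_def] at h ⊢; simpa using h
  have hrim : ∀ i : Fin N, ¬ N ≤ (Fin.castAdd M i).val := fun i => by simp
  refine tripleSplit_of_apices_rim w (Fin.castAdd M a) b c H (fun v => N ≤ v.val) id hH
    (fun u v _ _ e => e) (fun u v hu hv e => hI u v hu hv (hH' u v e)) ?_ ?_ ?_ ?_ (hrim a)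
  · intro p q r s hp hq hr hs hpq hrs l1 l2 l3
    obtain ⟨p, rfl⟩ := hcast p hp; obtain ⟨q, rfl⟩ := hcast q hq
    obtain ⟨r, rfl⟩ := hcast r hr; obtain ⟨s, rfl⟩ := hcast s hs
    exact hR p q r s (hH' _ _ hpq) (hH' _ _ hrs) (hlt _ _ l1) (hlt _ _ l2) (hlt _ _ l3)
  · intro x p q u v hx hp hq hpq hu hv l1 l2 l3
    obtain ⟨p, rfl⟩ := hcast p hp; obtain ⟨q, rfl⟩ := hcast q hq
    obtain ⟨u, rfl⟩ := hcast u (fun h => hI x _ hx h (hH' _ _ hu))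
    obtain ⟨v, rfl⟩ := hcast v (fun h => hI x _ hx h (hH' _ _ hv))
    refine hF x hx p q u v (hH' _ _ hpq) (hH' _ _ hu) (hH' _ _ hv) (hlt _ _ l1) (hlt _ _ l2) ?_
    rcases l3 with l3 | l3
    · exact Or.inl (hlt _ _ l3)
    · exact Or.inr (hlt _ _ l3)
  · intro x x' u v u' v' hx hx' hxx' hu hv hu' hv' l1 l2 l3
    obtain ⟨u, rfl⟩ := hcast u (fun h => hI x _ hx h (hH' _ _ hu))
    obtain ⟨v, rfl⟩ := hcast v (fun h => hI x _ hx h (hH' _ _ hv))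
    obtain ⟨u', rfl⟩ := hcast u' (fun h => hI x' _ hx' h (hH' _ _ hu'))
    obtain ⟨v', rfl⟩ := hcast v' (fun h => hI x' _ hx' h (hH' _ _ hv'))
    exact hL x x' hx hx' hxx' u v u' v' (hH' _ _ hu) (hH' _ _ hv) (hH' _ _ hu') (hH' _ _ hv') (hlt _ _ l1) (hlt _ _ l2)
      (hlt _ _ l3)
  · intro x x' u v t hx hx' hxx' huv hut hvt hu hv ht hu' hv' ht'
    obtain ⟨u, rfl⟩ := hcast u (fun h => hI x _ hx h (hH' _ _ hu))
    obtain ⟨v, rfl⟩ := hcast v (fun h => hI x _ hx h (hH' _ _ hv))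
    obtain ⟨t, rfl⟩ := hcast t (fun h => hI x _ hx h (hH' _ _ ht))
    exact hL2 x x' hx hx' hxx' u v t (fun e => huv (e ▸ rfl)) (fun e => hut (e ▸ rfl)) (fun e => hvt (e ▸ rfl))
      (hH' _ _ hu) (hH' _ _ hv) (hH' _ _ ht) (hH' _ _ hu') (hH' _ _ hv') (hH' _ _ ht')

end Consts

end Summit.CriticalPhenomena.PercolationContinuityZ3.Theorems
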